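import Summits.Parity.GeneralizedHardyLittlewood.Theses.LiouvilleShiftedTables
import Summits.Parity.GeneralizedHardyLittlewood.Theses.DicksonFibration
import Summits.Parity.GeneralizedHardyLittlewood.Theses.HullDial
import Summits.Parity.GeneralizedHardyLittlewood.Theorems.LiouvilleShiftedTablesPairsToGHLReduction
import Summits.Parity.GeneralizedHardyLittlewood.Theorems.LiouvilleShiftedTablesPairsToGHLPairSlice
import Summits.Parity.GeneralizedHardyLittlewood.Theorems.LiouvilleShiftedTablesPairsToGHLStubSingles
import Summits.Parity.GeneralizedHardyLittlewood.Theorems.LiouvilleShiftedTablesPairsToGHLStubSlopedEuler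
import Summits.Parity.GeneralizedHardyLittlewood.Theorems.LiouvilleShiftedTablesPairsToGHLStubToBounded
import Summits.Parity.GeneralizedHardyLittlewood.Theorems.LiouvilleShiftedTablesPairsToGHLStubRung
import Summits.Parity.GeneralizedHardyLittlewood.Theorems.LiouvilleShiftedTablesPairsToGHLStubRungAtoms
import Summits.Parity.GeneralizedHardyLittlewood.Theorems.LiouvilleShiftedTablesPairsToGHLStubRungLevel
import Summits.Parity.GeneralizedHardyLittlewood.Theorems.LiouvilleShiftedTablesPairsToGHLStubRungMain

/-!
# Line `sloped-ladder` for the crux `PairsToGHL` (stmt-Parity-9389, route LiouvilleShiftedTables)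

Strategist line (cstrat-stmt-Parity-9389-s1, 2026-08-17).  Kernel facts governing the crux (tree):
`PairsToGHL ↔ (PairsHL → DicksonFibration.DimOne)` with NO hypothesis
(`PairsToGHLReduction.pairsToGHL_iff_pairsHL_imp_dimOne`, p96099) and `DimOne → PairsToGHL`
(`pairsToGHL_of_dimOne`); the hypothesis `PairsHL` is inert (Disproof §2/§8).  Every concluding stub
set therefore carries `DimOne`; the only door is a re-typing in which as much of `DimOne` as possible
becomes THEOREM-GRADE work plus NAMED conjecture inputs of a different kind, and the GHL-hard remainder
is ONE strictly-weaker residual.  This line is Bombieri's asymptotic sieve run as an induction on the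
number of forms over ALL FIXED one-dimensional systems `Φ = (aᵢ n + bᵢ)ᵢ` (slopes `aᵢ ≥ 1`, shifts
`bᵢ ≥ 0`, non-degenerate), starting at `t = 1` (prime number theorem in progressions — a theorem, so
`PairsHL` is not even needed as the base), with

* `ElemHL(Φ)`  : `∑_{n ≤ N} ∏ᵢ Λ(aᵢ n + bᵢ) = 𝔖(Φ)·N + o(N)`, `𝔖(Φ) = singularProduct Φ` (Green–Tao);
* `Level(Φ)`   : relative Elliott–Halberstam for the weight `F_Φ(n) = ∏ᵢ Λ(aᵢ n + bᵢ)` in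
                 progressions to level `N^{1-δ}` (every `δ`), admissible classes equiprobable;
* `Atoms(Φ,ψ)` : `∑_{q ≤ N^{ε₀}} |∑_{n ≤ y_q, n ≡ w_q (q)} λ(ψ(n)) F_Φ(n)| ≤ C N/(log N)^A` for the
                 ADJOINED form `ψ` (one Liouville factor; the `k`-fold, sloped form of the route's
                 parity node `MAvg`/`LambdaLiouvilleLevel`).

Compared with the unit-slope ladder registered on the kernel-equivalent sibling crux stmt-Parity-14995
(`Cruxes/EngineToGHL/Lines/tuple_ladder.lean`, base `PairsHL`, residual `TuplesToDimOne` = slopes ⊕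
shift-uniformity): here SLOPES are inside the rung (progression/gcd bookkeeping, bounded multiplicities),
the base is `t = 1`, and the residual shrinks to exactly the SHIFT LIFT
`BoundedDickson (stmt-Parity-13151, verbatim) → DimOne (stmt-Parity-0819, verbatim)` — pointwise Dickson
⇒ shift-uniform Dickson, the Landau–Siegel-complete axis and nothing else (Goldbach in the shift, pairs
`h ≤ L N`; `Negative.not_generalizedHardyLittlewood_of_unboundedSiegelZeros`).  The two ladders are
NESTED (this rung at unit slopes is that rung): staff ONE of them.

STUBS — state 2026-08-17T05:15Z: ALL SEVEN theorem-grade stubs of this line are LANDED in Theorems/ (imported above,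
namespace `…Theorems.PairsToGHL.SlopedLadder`): `stub_singles` p139370, `stub_slopedEuler` p140620, `stub_toBounded` p140649,
`stub_slopedRung` (assembly form) p141246, `stub_rungAtomsPart` p142563, `stub_rungLevelPart` p142660, `stub_rungMainPart` p142750
(lead reshapes: #1 split the XL rung into the Euler identity + rung; #2 split the rung into atoms / level / main pieces + assembly).
The ONLY remaining `sorry`s are the declared conjecture-grade INPUTS `stub_slopedLevel` (relative tuple Elliott–Halberstam),
`stub_slopedAtoms` (one-Liouville-factor atom; `t = 1` instances = EH and the route's parity node) and the RESIDUAL `stub_shiftLift`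
(`BoundedDickson → DimOne`, Landau–Siegel-complete) — NOT proof targets.  The sorry-free ENGINE (`Level_all → Atoms_all →
ElemHL` for every fixed positive non-degenerate system, hence `BoundedDickson` and `PairsHL` from the two inputs) is landed
separately as `Theorems/LiouvilleShiftedTablesSlopedLadderEngine.lean`.
COMPOSITION `PairsToGHL_of` is sorry-free (`Nat.le_induction` on `t` + `pairsToGHL_of_dimOne`).
CERTIFICATES (sorry-free): `pairsHL_of_boundedDickson`, `shiftLift_of_pairsToGHL` (the residual is WEAKER
than the crux), `boundedDickson_of_dimOne` (the residual's hypothesis is implied by its conclusion).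
-/

namespace Summit.Parity.GeneralizedHardyLittlewood.Cruxes.PairsToGHL.SlopedLadder

open Summit.Parity.GeneralizedHardyLittlewood.Theses
open Summit.Parity.GeneralizedHardyLittlewood.Theorems

-- CLOSED stub `stub_singles`: landed as `Theorems.PairsToGHL.SlopedLadder.stub_singles` (imported above).

-- CLOSED stub `stub_slopedEuler`: landed as `Theorems.PairsToGHL.SlopedLadder.stub_slopedEuler` (imported above).

-- CLOSED stub `stub_rungAtomsPart`: landed as `Theorems.PairsToGHL.SlopedLadder.stub_rungAtomsPart` (Theorems/LiouvilleShiftedTablesPairsToGHLStubRungAtoms.lean, imported above).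

-- CLOSED stub `stub_rungLevelPart`: landed as `Theorems.PairsToGHL.SlopedLadder.stub_rungLevelPart` (Theorems/LiouvilleShiftedTablesPairsToGHLStubRungLevel.lean, imported above).

-- CLOSED stub `stub_rungMainPart`: landed as `Theorems.PairsToGHL.SlopedLadder.stub_rungMainPart` (Theorems/LiouvilleShiftedTablesPairsToGHLStubRungMain.lean, imported above).

-- CLOSED stub `stub_slopedRung`: landed as `Theorems.PairsToGHL.SlopedLadder.stub_slopedRung` (Theorems/LiouvilleShiftedTablesPairsToGHLStubRung.lean, imported above).


/-- **stub_slopedLevel — conjecture-grade INPUT (relative Elliott–Halberstam for the fixed tuple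
weight `F_Φ`; NOT a proof target).** For every positive non-degenerate `Φ` (`t ≥ 1`), `δ > 0`, `B`:
`∑_{d ≤ N^{1-δ}} |∑_{n ≤ y_d, n ≡ r_d (d)} F_Φ(n) - w_Φ(d,r_d) ∑_{n ≤ y_d} F_Φ(n)| ≤ C N/(log N)^B`,
`w_Φ(d,r) = 𝟙[(aᵢr+bᵢ, d) = 1 ∀ i]/#{ρ mod d : (aᵢρ+bᵢ, d) = 1 ∀ i}` — the Hardy–Littlewood
prediction for a fixed system in a progression IS "admissible classes equiprobable" (`β_p` of the
restricted system `Φ(r + d·k)` is `(p/(p-1))^t 𝟙[r admissible at p]` for `p ∣ d`; checked by hand for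
`t = 1`: `φ(a)/φ(ad) = 1/#{ρ : (aρ+b,d)=1}`).  `t = 1`, `Φ = (n)`: Elliott–Halberstam (the route's
declared bridge `ElliottHalberstam`, in `ψ(y;d,r) - ψ(y)/φ(d)` form); `t ≥ 2`: relative tuple-EH at
FIXED shifts = `TupleLevelOne` (stmt-Parity-14833) pointwise — outside the `z!`-shift witness that
refuted `TupleElliott` (stmt-Parity-14832) and outside the Siegel slice `h = 2q` of Matomäki–Merikoski
(Siegel-inert: fixed system, relative form).  Sources: ElliottHalberstam1970, FriedlanderGranville1989,
BombieriAsymptoticSieve1976, Polymath8b2014. -/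
theorem stub_slopedLevel :
    ∀ t : ℕ, 1 ≤ t → ∀ Φ : Fin t → Literature.NumberTheory.Sieve.AffLinForm 1, Literature.NumberTheory.Sieve.IsNondegenerateSystem Φ → (∀ i, 0 < (Φ i).coeff 0 ∧ 0 ≤ (Φ i).const) → (∀ δ : ℝ, 0 < δ → ∀ B : ℝ, ∃ C : ℝ, ∀ N : ℕ, 2 ≤ N → ∀ y r : ℕ → ℕ, (∀ d, y d ≤ N) → (∑ d ∈ Finset.Icc 1 ⌊(N : ℝ) ^ (1 - δ)⌋₊, |(∑ n ∈ (Finset.Icc 1 (y d)).filter (fun n : ℕ => n ≡ r d [MOD d]), ∏ i, Literature.NumberTheory.Sieve.intVonMangoldt ((Φ i).eval ![(n : ℤ)])) - (if ∀ i, Int.gcd ((Φ i).eval ![(r d : ℤ)]) d = 1 then ((((Finset.range d).filter (fun ρ : ℕ => ∀ i, Int.gcd ((Φ i).eval ![(ρ : ℤ)]) d = 1)).card : ℝ))⁻¹ else 0) * ∑ n ∈ Finset.Icc 1 (y d), ∏ i, Literature.NumberTheory.Sieve.intVonMangoldt ((Φ i).eval ![(n : ℤ)])|) ≤ C * N / Real.log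 N ^ B) := by
  sorry

/-- **stub_slopedAtoms — conjecture-grade PARITY INPUT (one Liouville factor on the adjoined form;
NOT a proof target).** For every positive `Φ`, `ψ` with `vecCons ψ Φ` non-degenerate there is `ε₀ > 0`
with, for every `A`: `∑_{q ≤ N^{ε₀}} |∑_{n ≤ y_q, n ≡ w_q (q)} λ(ψ(n)) F_Φ(n)| ≤ C N/(log N)^A`
(one residue, one height per modulus).  `Φ = (n)`, `ψ = n + h`: the route family's node
`LambdaLiouvilleLevel` / Bombieri's level-`N^ε` residual behind `MAvg` (stmt-Parity-0613) in `Λ·λ`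
clothing; `ψ = 2n+1`: the Sophie Germain parity atom; `q = 1`: a Hardy–Littlewood–Chowla correlation
with one Liouville factor (open; log-averaged or shift-averaged versions are known).  Non-degeneracy of the EXTENDED
system is load-bearing (`ψ = 2(n+1)` against `Φ = (n+1)` has `λ(ψ(n))Λ(n+1) = -Λ(n+1)` on primes: no
cancellation).  Parity-sensitive; NOT produced by this route's binary engine; Siegel-inert (fixed forms).
Sources: LichtmanTeravainen2022, Lichtman2020, TaoTeravainen2019OddChowla, MurtyVatwani2017. -/
theorem stub_slopedAtoms :
    ∀ t : ℕ, 1 ≤ t → ∀ (Φ : Fin t → Literature.NumberTheory.Sieve.AffLinForm 1) (ψ : Literature.NumberTheory.Sieve.AffLinForm 1), Literature.NumberTheory.Sieve.IsNondegenerateSystem (Matrix.vecCons ψ Φ) → (∀ i, 0 < (Φ i).coeff 0 ∧ 0 ≤ (Φ i).const) → (0 < ψ.coeff 0 ∧ 0 ≤ ψ.const) → (∃ ε₀ : ℝ, 0 < ε₀ ∧ ∀ A : ℝ, 0 < A → ∃ C : ℝ, ∃ N₀ : ℕ, ∀ N : ℕ, N₀ ≤ N → ∀ w y : ℕ → ℕ,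 (∀ q, y q ≤ N) → (∑ q ∈ Finset.Icc 1 ⌊(N : ℝ) ^ ε₀⌋₊, |∑ n ∈ (Finset.Icc 1 (y q)).filter (fun n : ℕ => n ≡ w q [MOD q]), (ArithmeticFunction.liouville (Int.toNat (ψ.eval ![(n : ℤ)])) : ℝ) * ∏ i, Literature.NumberTheory.Sieve.intVonMangoldt ((Φ i).eval ![(n : ℤ)])|) ≤ C * N / Real.log N ^ A) := by
  sorry

-- CLOSED stub `stub_toBounded`: landed as `Theorems.PairsToGHL.SlopedLadder.stub_toBounded` (imported above).

/-- **stub_shiftLift — the RESIDUAL (GHL-hard; NOT a proof target; strictly weaker than the crux).**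
`BoundedDickson` (stmt-Parity-13151 verbatim: Dickson–Hardy–Littlewood for every FIXED one-dimensional
system) `→ DimOne` (stmt-Parity-0819 verbatim: the same UNIFORMLY over `‖Φ‖_N ≤ L`, i.e. shifts
`|bᵢ| ≤ L·N`).  Content exactly the SHIFT LIFT: Goldbach `(n, M - n)` for every even `M ≤ LN`, pairs
`(n, n+h)` uniformly in `h ≤ LN`, … — Landau–Siegel-complete: under `UnboundedSiegelZeros` the fixed
systems are unobstructed (Matomäki–Merikoski Cor. 1.1) while the uniform clause fails at `h = 2q`,
`N = q^{10}` (`Negative.not_generalizedHardyLittlewood_of_unboundedSiegelZeros`), so this stub carries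
the WHOLE Siegel certificate of the crux and the other five stubs are Siegel-inert.  It is the common
residual of TwinMinorArcs (`ResidualLift` (b)), of the sibling ladder (`stub_tuplesToDimOne` minus
slopes) and of this crux; weaker than the crux (`shiftLift_of_pairsToGHL` below) and its hypothesis is
implied by its conclusion (`boundedDickson_of_dimOne` below).  Sources: GreenTao2010 Conj. 1.2,
MatomakiMerikoski2023 Thm 1.3 / Cor. 1.1, GoldstonSuriajaya2021, HardyLittlewood1923. -/
theorem stub_shiftLift :
    (∀ (t : ℕ) (Φ : Fin t → Literature.NumberTheory.Sieve.AffLinForm 1), 1 ≤ t → Literature.NumberTheory.Sieve.IsNondegenerateSystem Φ → ∀ ε : ℝ, 0 < ε → ∃ N₀ : ℕ, ∀ N : ℕ, N₀ ≤ N → ∀ K : Set (Fin 1 → ℝ), Convex ℝ K → K ⊆ Literature.NumberTheory.Sieve.realBox 1 N → |Literature.NumberTheory.Sieve.vonMangoldtSum Φ K N - Literature.NumberTheory.Sieve.archFactor Φ K * Literature.NumberTheory.Sieve.singularProduct Φ| ≤ ε * N) →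
      ∀ (t L : ℕ), 1 ≤ t → ∀ ε : ℝ, 0 < ε → ∃ N₀ : ℕ, ∀ N : ℕ, N₀ ≤ N → ∀ Ψ : Fin t → Literature.NumberTheory.Sieve.AffLinForm 1, Literature.NumberTheory.Sieve.IsNondegenerateSystem Ψ → Literature.NumberTheory.Sieve.affLinSize Ψ N ≤ L → ∀ K : Set (Fin 1 → ℝ), Convex ℝ K → K ⊆ Literature.NumberTheory.Sieve.realBox 1 N → |Literature.NumberTheory.Sieve.vonMangoldtSum Ψ K N - Literature.NumberTheory.Sieve.archFactor Ψ K * Literature.NumberTheory.Sieve.singularProduct Ψ| ≤ ε * (N : ℝ) := by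
  sorry

/-! ### Composition (sorry-free) -/

/-- **Composition of line `sloped-ladder`.** The crux BY NAME from the seven stub statements: induction on
the number of forms from the base `t = 1` (`Nat.le_induction`), Green–Tao normalisation, the shift
lift, and `pairsToGHL_of_dimOne` (p96099).  The crux hypothesis `PairsHL` is not used (it is the
`t = 2`, unit-slope instance of the ladder's own output — see `pairsHL_of_boundedDickson`). [folklore] -/
theorem PairsToGHL_of :
    (∀ Φ : Fin 1 → Literature.NumberTheory.Sieve.AffLinForm 1, Literature.NumberTheory.Sieve.IsNondegenerateSystem Φ → (∀ i, 0 < (Φ i).coeff 0 ∧ 0 ≤ (Φ i).const) → ((fun N : ℕ => ∑ n ∈ Finset.Icc 1 N, ∏ i, Literature.NumberTheory.Sieve.intVonMangoldt ((Φ i).eval ![(n : ℤ)]) - Literature.NumberTheory.Sieve.singularProduct Φ * N) =o[Filter.atTop] fun N : ℕ => (N : ℝ))) →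
    (∀ t : ℕ, 1 ≤ t → ∀ (Φ : Fin t → Literature.NumberTheory.Sieve.AffLinForm 1) (ψ : Literature.NumberTheory.Sieve.AffLinForm 1), Literature.NumberTheory.Sieve.IsNondegenerateSystem (Matrix.vecCons ψ Φ) → (∀ i, 0 < (Φ i).coeff 0 ∧ 0 ≤ (Φ i).const) → (0 < ψ.coeff 0 ∧ 0 ≤ ψ.const) → (∃ ε₀ : ℝ, 0 < ε₀ ∧ ∀ A : ℝ, 0 < A → ∃ C : ℝ, ∃ N₀ : ℕ, ∀ N : ℕ, N₀ ≤ N → ∀ w y : ℕ → ℕ, (∀ q, y q ≤ N) → (∑ q ∈ Finset.Icc 1 ⌊(N : ℝ) ^ ε₀⌋₊, |∑ n ∈ (Finset.Icc 1 (y q)).filter (fun n : ℕ => n ≡ w q [MOD q]), (ArithmeticFunction.liouville (Int.toNat (ψ.eval ![(n : ℤ)])) : ℝ) * ∏ i, Literature.NumberTheory.Sieve.intVonMangoldt ((Φ i).eval ![(n : ℤ)])|) ≤ C * N / Real.log N ^ A) → ∃ ε₁ : ℝ, 0 < ε₁ ∧ ε₁ ≤ 1 / 8 ∧ ∀ η :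 ℝ, 0 < η → ∃ N₀ : ℕ, ∀ N : ℕ, N₀ ≤ N → |∑ n ∈ Finset.Icc 1 N, (∏ i, Literature.NumberTheory.Sieve.intVonMangoldt ((Φ i).eval ![(n : ℤ)])) * ∑ x ∈ (Nat.divisorsAntidiagonal (Int.toNat (ψ.eval ![(n : ℤ)]))).filter (fun x : ℕ × ℕ => x.2 ≤ ⌊(N : ℝ) ^ ε₁⌋₊), (ArithmeticFunction.moebius x.1 : ℝ) * Real.log x.2| ≤ η * N) →
    (∀ t : ℕ, 1 ≤ t → ∀ (Φ : Fin t → Literature.NumberTheory.Sieve.AffLinForm 1) (ψ : Literature.NumberTheory.Sieve.AffLinForm 1), Literature.NumberTheory.Sieve.IsNondegenerateSystem (Matrix.vecCons ψ Φ) → (∀ i, 0 < (Φ i).coeff 0 ∧ 0 ≤ (Φ i).const) → (0 < ψ.coeff 0 ∧ 0 ≤ ψ.const) → (∀ δ : ℝ, 0 < δ → ∀ B : ℝ, ∃ C : ℝ, ∀ N : ℕ, 2 ≤ N → ∀ y r : ℕ → ℕ, (∀ d, y d ≤ N) → (∑ d ∈ Finset.Icc 1 ⌊(N : ℝ) ^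 (1 - δ)⌋₊, |(∑ n ∈ (Finset.Icc 1 (y d)).filter (fun n : ℕ => n ≡ r d [MOD d]), ∏ i, Literature.NumberTheory.Sieve.intVonMangoldt ((Φ i).eval ![(n : ℤ)])) - (if ∀ i, Int.gcd ((Φ i).eval ![(r d : ℤ)]) d = 1 then ((((Finset.range d).filter (fun ρ : ℕ => ∀ i, Int.gcd ((Φ i).eval ![(ρ : ℤ)]) d = 1)).card : ℝ))⁻¹ else 0) * ∑ n ∈ Finset.Icc 1 (y d), ∏ i, Literature.NumberTheory.Sieve.intVonMangoldt ((Φ i).eval ![(n : ℤ)])|) ≤ C * N / Real.log N ^ B) → ∀ ε₁ : ℝ, 0 < ε₁ → ε₁ ≤ 1 / 8 → ∀ η : ℝ, 0 < η → ∃ N₀ : ℕ, ∀ N : ℕ, N₀ ≤ N → |∑ n ∈ Finset.Icc 1 N, (∏ i, Literature.NumberTheory.Sieve.intVonMangoldt ((Φ i).eval ![(n : ℤ)])) * ∑ d ∈ Finset.Icc 1 (Int.toNat (ψ.eval ![(n : ℤ)]) / (⌊(N : ℝ) ^ ε₁⌋₊ + 1)), (ArithmeticFunction.moebius d : ℝ)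 * ((if d ∣ Int.toNat (ψ.eval ![(n : ℤ)]) then (1 : ℝ) else 0) - (∑ ρ ∈ Finset.range (d / Int.gcd (ψ.coeff 0) d), if (d : ℤ) ∣ ψ.eval ![(ρ : ℤ)] then (if ∀ i, Int.gcd ((Φ i).eval ![(ρ : ℤ)]) (d / Int.gcd (ψ.coeff 0) d) = 1 then ((((Finset.range (d / Int.gcd (ψ.coeff 0) d)).filter (fun ρ' : ℕ => ∀ i, Int.gcd ((Φ i).eval ![(ρ' : ℤ)]) (d / Int.gcd (ψ.coeff 0) d) = 1)).card : ℝ))⁻¹ else 0) else (0 : ℝ))) * Real.log ((Int.toNat (ψ.eval ![(n : ℤ)]) : ℝ) / d)| ≤ η * N) →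
    (∀ t : ℕ, 1 ≤ t → ∀ (Φ : Fin t → Literature.NumberTheory.Sieve.AffLinForm 1) (ψ : Literature.NumberTheory.Sieve.AffLinForm 1), Literature.NumberTheory.Sieve.IsNondegenerateSystem (Matrix.vecCons ψ Φ) → (∀ i, 0 < (Φ i).coeff 0 ∧ 0 ≤ (Φ i).const) → (0 < ψ.coeff 0 ∧ 0 ≤ ψ.const) → ((fun N : ℕ => ∑ n ∈ Finset.Icc 1 N, ∏ i, Literature.NumberTheory.Sieve.intVonMangoldt ((Φ i).eval ![(n : ℤ)]) - Literature.NumberTheory.Sieve.singularProduct Φ * N) =o[Filter.atTop] fun N : ℕ => (N : ℝ)) → (∃ C : ℝ, ∀ x : ℕ, 2 ≤ x → |∑ d ∈ Finset.Icc 1 x, (ArithmeticFunction.moebius d : ℝ) * (∑ ρ ∈ Finset.range (d / Int.gcd (ψ.coeff 0) d), if (d : ℤ) ∣ ψ.eval ![(ρ : ℤ)] then (if ∀ i, Int.gcd ((Φ i).eval ![(ρ : ℤ)]) (d / Int.gcd (ψ.coeff 0) d) = 1 then ((((Finset.range (d / Int.gcd (ψ.coeff 0) d)).filter (fun ρ'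 : ℕ => ∀ i, Int.gcd ((Φ i).eval ![(ρ' : ℤ)]) (d / Int.gcd (ψ.coeff 0) d) = 1)).card : ℝ))⁻¹ else 0) else (0 : ℝ))| ≤ C / Real.log x ^ 2 ∧ |∑ d ∈ Finset.Icc 1 x, (ArithmeticFunction.moebius d : ℝ) * (∑ ρ ∈ Finset.range (d / Int.gcd (ψ.coeff 0) d), if (d : ℤ) ∣ ψ.eval ![(ρ : ℤ)] then (if ∀ i, Int.gcd ((Φ i).eval ![(ρ : ℤ)]) (d / Int.gcd (ψ.coeff 0) d) = 1 then ((((Finset.range (d / Int.gcd (ψ.coeff 0) d)).filter (fun ρ' : ℕ => ∀ i, Int.gcd ((Φ i).eval ![(ρ' : ℤ)]) (d / Int.gcd (ψ.coeff 0) d) = 1)).card : ℝ))⁻¹ else 0) else (0 : ℝ)) * Real.log d| ≤ C ∧ |Literature.NumberTheory.Sieve.singularProduct Φ * (∑ d ∈ Finset.Icc 1 x, (ArithmeticFunction.moebius d : ℝ) * (∑ ρ ∈ Finset.range (d / Int.gcd (ψ.coeff 0) d), if (d : ℤ) ∣ ψ.eval ![(ρ : ℤ)] then (if ∀ i, Int.gcd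 ((Φ i).eval ![(ρ : ℤ)]) (d / Int.gcd (ψ.coeff 0) d) = 1 then ((((Finset.range (d / Int.gcd (ψ.coeff 0) d)).filter (fun ρ' : ℕ => ∀ i, Int.gcd ((Φ i).eval ![(ρ' : ℤ)]) (d / Int.gcd (ψ.coeff 0) d) = 1)).card : ℝ))⁻¹ else 0) else (0 : ℝ)) * Real.log d) + Literature.NumberTheory.Sieve.singularProduct (Matrix.vecCons ψ Φ)| ≤ C / Real.log x) → ∀ ε₁ : ℝ, 0 < ε₁ → ε₁ ≤ 1 / 8 → ∀ η : ℝ, 0 < η → ∃ N₀ : ℕ, ∀ N : ℕ, N₀ ≤ N → |∑ n ∈ Finset.Icc 1 N, (∏ i, Literature.NumberTheory.Sieve.intVonMangoldt ((Φ i).eval ![(n : ℤ)])) * ∑ d ∈ Finset.Icc 1 (Int.toNat (ψ.eval ![(n : ℤ)]) / (⌊(N : ℝ) ^ ε₁⌋₊ + 1)), (ArithmeticFunction.moebius d : ℝ) * (∑ ρ ∈ Finset.range (d / Int.gcd (ψ.coeff 0) d), if (d : ℤ) ∣ ψ.eval ![(ρ : ℤ)] then (if ∀ i, Int.gcd ((Φ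 i).eval ![(ρ : ℤ)]) (d / Int.gcd (ψ.coeff 0) d) = 1 then ((((Finset.range (d / Int.gcd (ψ.coeff 0) d)).filter (fun ρ' : ℕ => ∀ i, Int.gcd ((Φ i).eval ![(ρ' : ℤ)]) (d / Int.gcd (ψ.coeff 0) d) = 1)).card : ℝ))⁻¹ else 0) else (0 : ℝ)) * Real.log ((Int.toNat (ψ.eval ![(n : ℤ)]) : ℝ) / d) - Literature.NumberTheory.Sieve.singularProduct (Matrix.vecCons ψ Φ) * N| ≤ η * N) →
    (∀ t : ℕ, 1 ≤ t →
      (∀ (Φ : Fin t → Literature.NumberTheory.Sieve.AffLinForm 1) (ψ : Literature.NumberTheory.Sieve.AffLinForm 1), Literature.NumberTheory.Sieve.IsNondegenerateSystem (Matrix.vecCons ψ Φ) → (∀ i, 0 < (Φ i).coeff 0 ∧ 0 ≤ (Φ i).const) → (0 < ψ.coeff 0 ∧ 0 ≤ ψ.const) → ∃ ε₁ : ℝ, 0 < ε₁ ∧ ε₁ ≤ 1 / 8 ∧ ∀ η : ℝ, 0 < η → ∃ N₀ : ℕ, ∀ N : ℕ, N₀ ≤ N → |∑ n ∈ Finset.Icc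 1 N, (∏ i, Literature.NumberTheory.Sieve.intVonMangoldt ((Φ i).eval ![(n : ℤ)])) * ∑ x ∈ (Nat.divisorsAntidiagonal (Int.toNat (ψ.eval ![(n : ℤ)]))).filter (fun x : ℕ × ℕ => x.2 ≤ ⌊(N : ℝ) ^ ε₁⌋₊), (ArithmeticFunction.moebius x.1 : ℝ) * Real.log x.2| ≤ η * N) →
      (∀ (Φ : Fin t → Literature.NumberTheory.Sieve.AffLinForm 1) (ψ : Literature.NumberTheory.Sieve.AffLinForm 1), Literature.NumberTheory.Sieve.IsNondegenerateSystem (Matrix.vecCons ψ Φ) → (∀ i, 0 < (Φ i).coeff 0 ∧ 0 ≤ (Φ i).const) → (0 < ψ.coeff 0 ∧ 0 ≤ ψ.const) → ∀ ε₁ : ℝ, 0 < ε₁ → ε₁ ≤ 1 / 8 → ∀ η : ℝ, 0 < η → ∃ N₀ : ℕ, ∀ N : ℕ, N₀ ≤ N → |∑ n ∈ Finset.Icc 1 N, (∏ i, Literature.NumberTheory.Sieve.intVonMangoldt ((Φ i).eval ![(n : ℤ)])) * ∑ d ∈ Finset.Icc 1 (Int.toNat (ψ.eval ![(n : ℤ)])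 / (⌊(N : ℝ) ^ ε₁⌋₊ + 1)), (ArithmeticFunction.moebius d : ℝ) * ((if d ∣ Int.toNat (ψ.eval ![(n : ℤ)]) then (1 : ℝ) else 0) - (∑ ρ ∈ Finset.range (d / Int.gcd (ψ.coeff 0) d), if (d : ℤ) ∣ ψ.eval ![(ρ : ℤ)] then (if ∀ i, Int.gcd ((Φ i).eval ![(ρ : ℤ)]) (d / Int.gcd (ψ.coeff 0) d) = 1 then ((((Finset.range (d / Int.gcd (ψ.coeff 0) d)).filter (fun ρ' : ℕ => ∀ i, Int.gcd ((Φ i).eval ![(ρ' : ℤ)]) (d / Int.gcd (ψ.coeff 0) d) = 1)).card : ℝ))⁻¹ else 0) else (0 : ℝ))) * Real.log ((Int.toNat (ψ.eval ![(n : ℤ)]) : ℝ) / d)| ≤ η * N) →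
      (∀ (Φ : Fin t → Literature.NumberTheory.Sieve.AffLinForm 1) (ψ : Literature.NumberTheory.Sieve.AffLinForm 1), Literature.NumberTheory.Sieve.IsNondegenerateSystem (Matrix.vecCons ψ Φ) → (∀ i, 0 < (Φ i).coeff 0 ∧ 0 ≤ (Φ i).const) → (0 < ψ.coeff 0 ∧ 0 ≤ ψ.const) → ∀ ε₁ : ℝ, 0 < ε₁ → ε₁ ≤ 1 / 8 → ∀ η : ℝ, 0 < η → ∃ N₀ : ℕ, ∀ N : ℕ, N₀ ≤ N → |∑ n ∈ Finset.Icc 1 N, (∏ i, Literature.NumberTheory.Sieve.intVonMangoldt ((Φ i).eval ![(n : ℤ)])) * ∑ d ∈ Finset.Icc 1 (Int.toNat (ψ.eval ![(n : ℤ)]) / (⌊(N : ℝ) ^ ε₁⌋₊ + 1)), (ArithmeticFunction.moebius d : ℝ) * (∑ ρ ∈ Finset.range (d / Int.gcd (ψ.coeff 0) d), if (d : ℤ) ∣ ψ.eval ![(ρ : ℤ)] then (if ∀ i, Int.gcd ((Φ i).eval ![(ρ : ℤ)]) (d / Int.gcd (ψ.coeff 0) d) = 1 then ((((Finset.range (d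 / Int.gcd (ψ.coeff 0) d)).filter (fun ρ' : ℕ => ∀ i, Int.gcd ((Φ i).eval ![(ρ' : ℤ)]) (d / Int.gcd (ψ.coeff 0) d) = 1)).card : ℝ))⁻¹ else 0) else (0 : ℝ)) * Real.log ((Int.toNat (ψ.eval ![(n : ℤ)]) : ℝ) / d) - Literature.NumberTheory.Sieve.singularProduct (Matrix.vecCons ψ Φ) * N| ≤ η * N) →
      ∀ Φ : Fin (t + 1) → Literature.NumberTheory.Sieve.AffLinForm 1, Literature.NumberTheory.Sieve.IsNondegenerateSystem Φ → (∀ i, 0 < (Φ i).coeff 0 ∧ 0 ≤ (Φ i).const) → ((fun N : ℕ => ∑ n ∈ Finset.Icc 1 N, ∏ i, Literature.NumberTheory.Sieve.intVonMangoldt ((Φ i).eval ![(n : ℤ)]) - Literature.NumberTheory.Sieve.singularProduct Φ * N) =o[Filter.atTop] fun N : ℕ => (N : ℝ))) →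
    (∀ t : ℕ, 1 ≤ t → ∀ Φ : Fin t → Literature.NumberTheory.Sieve.AffLinForm 1, Literature.NumberTheory.Sieve.IsNondegenerateSystem Φ → (∀ i, 0 < (Φ i).coeff 0 ∧ 0 ≤ (Φ i).const) → (∀ δ : ℝ, 0 < δ → ∀ B : ℝ, ∃ C : ℝ, ∀ N : ℕ, 2 ≤ N → ∀ y r : ℕ → ℕ, (∀ d, y d ≤ N) → (∑ d ∈ Finset.Icc 1 ⌊(N : ℝ) ^ (1 - δ)⌋₊, |(∑ n ∈ (Finset.Icc 1 (y d)).filter (fun n : ℕ => n ≡ r d [MOD d]), ∏ i, Literature.NumberTheory.Sieve.intVonMangoldt ((Φ i).eval ![(n : ℤ)])) - (if ∀ i, Int.gcd ((Φ i).eval ![(r d : ℤ)]) d = 1 then ((((Finset.range d).filter (fun ρ : ℕ => ∀ i, Int.gcd ((Φ i).eval ![(ρ : ℤ)]) d = 1)).card : ℝ))⁻¹ else 0) * ∑ n ∈ Finset.Icc 1 (y d), ∏ i, Literature.NumberTheory.Sieve.intVonMangoldt ((Φ i).eval ![(n : ℤ)])|) ≤ C * N / Real.log N ^ B)) →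
    (∀ t : ℕ, 1 ≤ t → ∀ (Φ : Fin t → Literature.NumberTheory.Sieve.AffLinForm 1) (ψ : Literature.NumberTheory.Sieve.AffLinForm 1), Literature.NumberTheory.Sieve.IsNondegenerateSystem (Matrix.vecCons ψ Φ) → (∀ i, 0 < (Φ i).coeff 0 ∧ 0 ≤ (Φ i).const) → (0 < ψ.coeff 0 ∧ 0 ≤ ψ.const) → (∃ ε₀ : ℝ, 0 < ε₀ ∧ ∀ A : ℝ, 0 < A → ∃ C : ℝ, ∃ N₀ : ℕ, ∀ N : ℕ, N₀ ≤ N → ∀ w y : ℕ → ℕ, (∀ q, y q ≤ N) → (∑ q ∈ Finset.Icc 1 ⌊(N : ℝ) ^ ε₀⌋₊, |∑ n ∈ (Finset.Icc 1 (y q)).filter (fun n : ℕ => n ≡ w q [MOD q]), (ArithmeticFunction.liouville (Int.toNat (ψ.eval ![(n : ℤ)])) : ℝ) * ∏ i, Literature.NumberTheory.Sieve.intVonMangoldt ((Φ i).eval ![(n : ℤ)])|) ≤ C * N / Real.log N ^ A)) →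
    (∀ t : ℕ, 1 ≤ t → ∀ (Φ : Fin t → Literature.NumberTheory.Sieve.AffLinForm 1) (ψ : Literature.NumberTheory.Sieve.AffLinForm 1), Literature.NumberTheory.Sieve.IsNondegenerateSystem (Matrix.vecCons ψ Φ) → (∀ i, 0 < (Φ i).coeff 0 ∧ 0 ≤ (Φ i).const) → (0 < ψ.coeff 0 ∧ 0 ≤ ψ.const) → ∃ C : ℝ, ∀ x : ℕ, 2 ≤ x → |∑ d ∈ Finset.Icc 1 x, (ArithmeticFunction.moebius d : ℝ) * (∑ ρ ∈ Finset.range (d / Int.gcd (ψ.coeff 0) d), if (d : ℤ) ∣ ψ.eval ![(ρ : ℤ)] then (if ∀ i, Int.gcd ((Φ i).eval ![(ρ : ℤ)]) (d / Int.gcd (ψ.coeff 0) d) = 1 then ((((Finset.range (d / Int.gcd (ψ.coeff 0) d)).filter (fun ρ' : ℕ => ∀ i, Int.gcd ((Φ i).eval ![(ρ' : ℤ)]) (d / Int.gcd (ψ.coeff 0) d) = 1)).card : ℝ))⁻¹ else 0) else (0 : ℝ))| ≤ C / Real.log x ^ 2 ∧ |∑ d ∈ Finset.Icc 1 x, (ArithmeticFunction.moebius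 d : ℝ) * (∑ ρ ∈ Finset.range (d / Int.gcd (ψ.coeff 0) d), if (d : ℤ) ∣ ψ.eval ![(ρ : ℤ)] then (if ∀ i, Int.gcd ((Φ i).eval ![(ρ : ℤ)]) (d / Int.gcd (ψ.coeff 0) d) = 1 then ((((Finset.range (d / Int.gcd (ψ.coeff 0) d)).filter (fun ρ' : ℕ => ∀ i, Int.gcd ((Φ i).eval ![(ρ' : ℤ)]) (d / Int.gcd (ψ.coeff 0) d) = 1)).card : ℝ))⁻¹ else 0) else (0 : ℝ)) * Real.log d| ≤ C ∧ |Literature.NumberTheory.Sieve.singularProduct Φ * (∑ d ∈ Finset.Icc 1 x, (ArithmeticFunction.moebius d : ℝ) * (∑ ρ ∈ Finset.range (d / Int.gcd (ψ.coeff 0) d), if (d : ℤ) ∣ ψ.eval ![(ρ : ℤ)] then (if ∀ i, Int.gcd ((Φ i).eval ![(ρ : ℤ)]) (d / Int.gcd (ψ.coeff 0) d) = 1 then ((((Finset.range (d / Int.gcd (ψ.coeff 0) d)).filter (fun ρ' : ℕ => ∀ i, Int.gcd ((Φ i).eval ![(ρ' : ℤ)]) (d / Int.gcd (ψ.coeff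 0) d) = 1)).card : ℝ))⁻¹ else 0) else (0 : ℝ)) * Real.log d) + Literature.NumberTheory.Sieve.singularProduct (Matrix.vecCons ψ Φ)| ≤ C / Real.log x) →
    ((∀ t : ℕ, 1 ≤ t → ∀ Φ : Fin t → Literature.NumberTheory.Sieve.AffLinForm 1, Literature.NumberTheory.Sieve.IsNondegenerateSystem Φ → (∀ i, 0 < (Φ i).coeff 0 ∧ 0 ≤ (Φ i).const) → ((fun N : ℕ => ∑ n ∈ Finset.Icc 1 N, ∏ i, Literature.NumberTheory.Sieve.intVonMangoldt ((Φ i).eval ![(n : ℤ)]) - Literature.NumberTheory.Sieve.singularProduct Φ * N) =o[Filter.atTop] fun N : ℕ => (N : ℝ))) →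
      ∀ (t : ℕ) (Φ : Fin t → Literature.NumberTheory.Sieve.AffLinForm 1), 1 ≤ t → Literature.NumberTheory.Sieve.IsNondegenerateSystem Φ → ∀ ε : ℝ, 0 < ε → ∃ N₀ : ℕ, ∀ N : ℕ, N₀ ≤ N → ∀ K : Set (Fin 1 → ℝ), Convex ℝ K → K ⊆ Literature.NumberTheory.Sieve.realBox 1 N → |Literature.NumberTheory.Sieve.vonMangoldtSum Φ K N - Literature.NumberTheory.Sieve.archFactor Φ K * Literature.NumberTheory.Sieve.singularProduct Φ| ≤ ε * N) →
    ((∀ (t : ℕ) (Φ : Fin t → Literature.NumberTheory.Sieve.AffLinForm 1), 1 ≤ t → Literature.NumberTheory.Sieve.IsNondegenerateSystem Φ → ∀ ε : ℝ, 0 < ε → ∃ N₀ : ℕ, ∀ N : ℕ, N₀ ≤ N → ∀ K : Set (Fin 1 → ℝ), Convex ℝ K → K ⊆ Literature.NumberTheory.Sieve.realBox 1 N → |Literature.NumberTheory.Sieve.vonMangoldtSum Φ K N - Literature.NumberTheory.Sieve.archFactor Φ K * Literature.NumberTheory.Sieve.singularProduct Φ| ≤ ε * N) →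
      ∀ (t L : ℕ), 1 ≤ t → ∀ ε : ℝ, 0 < ε → ∃ N₀ : ℕ, ∀ N : ℕ, N₀ ≤ N → ∀ Ψ : Fin t → Literature.NumberTheory.Sieve.AffLinForm 1, Literature.NumberTheory.Sieve.IsNondegenerateSystem Ψ → Literature.NumberTheory.Sieve.affLinSize Ψ N ≤ L → ∀ K : Set (Fin 1 → ℝ), Convex ℝ K → K ⊆ Literature.NumberTheory.Sieve.realBox 1 N → |Literature.NumberTheory.Sieve.vonMangoldtSum Ψ K N - Literature.NumberTheory.Sieve.archFactor Ψ K * Literature.NumberTheory.Sieve.singularProduct Ψ| ≤ ε * (N : ℝ)) →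
    Summit.Parity.GeneralizedHardyLittlewood.Theses.LiouvilleShiftedTables.PairsToGHL := by
  intro h1 hA hL hM hR h3 h4 hE h5 h6
  have hall : ∀ t : ℕ, 1 ≤ t → ∀ Φ : Fin t → Literature.NumberTheory.Sieve.AffLinForm 1, Literature.NumberTheory.Sieve.IsNondegenerateSystem Φ → (∀ i, 0 < (Φ i).coeff 0 ∧ 0 ≤ (Φ i).const) → ((fun N : ℕ => ∑ n ∈ Finset.Icc 1 N, ∏ i, Literature.NumberTheory.Sieve.intVonMangoldt ((Φ i).eval ![(n : ℤ)]) - Literature.NumberTheory.Sieve.singularProduct Φ * N) =o[Filter.atTop] fun N : ℕ => (N : ℝ)) := by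
    intro t ht
    induction t, ht using Nat.le_induction with
    | base => exact h1
    | succ t ht ih =>
        refine hR t ht (fun Φ ψ hn hp hq => hA t ht Φ ψ hn hp hq (h4 t ht Φ ψ hn hp hq))
          (fun Φ ψ hn hp hq => hL t ht Φ ψ hn hp hq
            (h3 t ht Φ (PairsToGHL.SlopedLadder.isNondegenerateSystem_tail Φ ψ hn) hp))
          (fun Φ ψ hn hp hq => hM t ht Φ ψ hn hp hq
            (ih Φ (PairsToGHL.SlopedLadder.isNondegenerateSystem_tail Φ ψ hn) hp) (hE t ht Φ ψ hn hp hq))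
  have hD : DicksonFibration.DimOne := h6 (h5 hall)
  exact PairsToGHLReduction.pairsToGHL_of_dimOne hD

/-- The crux, closed modulo the seven stubs (sorries live only in `stub_*`). [folklore] -/
theorem PairsToGHL_closed : Summit.Parity.GeneralizedHardyLittlewood.Theses.LiouvilleShiftedTables.PairsToGHL :=
  PairsToGHL_of PairsToGHL.SlopedLadder.stub_singles PairsToGHL.SlopedLadder.stub_rungAtomsPart
    PairsToGHL.SlopedLadder.stub_rungLevelPart PairsToGHL.SlopedLadder.stub_rungMainPart
    PairsToGHL.SlopedLadder.stub_slopedRung stub_slopedLevel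
    stub_slopedAtoms
    PairsToGHL.SlopedLadder.stub_slopedEuler PairsToGHL.SlopedLadder.stub_toBounded stub_shiftLift

/-- The shared item's OTHER route copy (route HullDial, same ledger item stmt-Parity-9389, identical text):
closed modulo the same stubs, so that `skeleton check` resolves against either route decl. [folklore] -/
theorem PairsToGHL_closed_hullDial : Summit.Parity.GeneralizedHardyLittlewood.Theses.HullDial.PairsToGHL :=
  PairsToGHL_closed

/-! ### Prepared route split (sorry-free glue; for the lead's final cycle / tenure)

Four children bundle the six stubs: `SlopedLadderEngine` (= `stub_singles` + `stub_slopedRung`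
composed: the two INPUT families imply elementary Hardy–Littlewood for every positive non-degenerate
fixed system — theorem-grade), `SlopedLevelAll` (= `stub_slopedLevel`), `SlopedAtomsAll`
(= `stub_slopedAtoms`), `FixedToDimOne` (= `stub_toBounded` + `stub_shiftLift` composed: the residual,
whose provable half is the Green–Tao normalisation).  `ledger route edit route-Parity-LiouvilleShiftedTables
--split PairsToGHL --into SlopedLadderEngine SlopedLevelAll SlopedAtomsAll FixedToDimOne --glue
'…SlopedLadder.PairsToGHL_of_split'` (4 children: planner-approved). -/

/-- Glue of the prepared 4-child split: `SlopedLadderEngine → SlopedLevelAll → SlopedAtomsAll →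
FixedToDimOne → PairsToGHL`. [folklore] -/
theorem PairsToGHL_of_split :
    ((∀ t : ℕ, 1 ≤ t → ∀ Φ : Fin t → Literature.NumberTheory.Sieve.AffLinForm 1, Literature.NumberTheory.Sieve.IsNondegenerateSystem Φ → (∀ i, 0 < (Φ i).coeff 0 ∧ 0 ≤ (Φ i).const) → (∀ δ : ℝ, 0 < δ → ∀ B : ℝ, ∃ C : ℝ, ∀ N : ℕ, 2 ≤ N → ∀ y r : ℕ → ℕ, (∀ d, y d ≤ N) → (∑ d ∈ Finset.Icc 1 ⌊(N : ℝ) ^ (1 - δ)⌋₊, |(∑ n ∈ (Finset.Icc 1 (y d)).filter (fun n : ℕ => n ≡ r d [MOD d]), ∏ i, Literature.NumberTheory.Sieve.intVonMangoldt ((Φ i).eval ![(n : ℤ)])) - (if ∀ i, Int.gcd ((Φ i).eval ![(r d : ℤ)]) d = 1 then ((((Finset.range d).filter (fun ρ : ℕ => ∀ i, Int.gcd ((Φ i).eval ![(ρ : ℤ)]) d = 1)).card : ℝ))⁻¹ else 0) * ∑ n ∈ Finset.Icc 1 (y d), ∏ i, Literature.NumberTheory.Sieve.intVonMangoldt ((Φ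 i).eval ![(n : ℤ)])|) ≤ C * N / Real.log N ^ B)) →
      (∀ t : ℕ, 1 ≤ t → ∀ (Φ : Fin t → Literature.NumberTheory.Sieve.AffLinForm 1) (ψ : Literature.NumberTheory.Sieve.AffLinForm 1), Literature.NumberTheory.Sieve.IsNondegenerateSystem (Matrix.vecCons ψ Φ) → (∀ i, 0 < (Φ i).coeff 0 ∧ 0 ≤ (Φ i).const) → (0 < ψ.coeff 0 ∧ 0 ≤ ψ.const) → (∃ ε₀ : ℝ, 0 < ε₀ ∧ ∀ A : ℝ, 0 < A → ∃ C : ℝ, ∃ N₀ : ℕ, ∀ N : ℕ, N₀ ≤ N → ∀ w y : ℕ → ℕ, (∀ q, y q ≤ N) → (∑ q ∈ Finset.Icc 1 ⌊(N : ℝ) ^ ε₀⌋₊, |∑ n ∈ (Finset.Icc 1 (y q)).filter (fun n : ℕ => n ≡ w q [MOD q]), (ArithmeticFunction.liouville (Int.toNat (ψ.eval ![(n : ℤ)])) : ℝ) * ∏ i, Literature.NumberTheory.Sieve.intVonMangoldt ((Φ i).eval ![(n : ℤ)])|) ≤ C * N / Real.log N ^ A)) →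
      ∀ t : ℕ, 1 ≤ t → ∀ Φ : Fin t → Literature.NumberTheory.Sieve.AffLinForm 1, Literature.NumberTheory.Sieve.IsNondegenerateSystem Φ → (∀ i, 0 < (Φ i).coeff 0 ∧ 0 ≤ (Φ i).const) → ((fun N : ℕ => ∑ n ∈ Finset.Icc 1 N, ∏ i, Literature.NumberTheory.Sieve.intVonMangoldt ((Φ i).eval ![(n : ℤ)]) - Literature.NumberTheory.Sieve.singularProduct Φ * N) =o[Filter.atTop] fun N : ℕ => (N : ℝ))) →
    (∀ t : ℕ, 1 ≤ t → ∀ Φ : Fin t → Literature.NumberTheory.Sieve.AffLinForm 1, Literature.NumberTheory.Sieve.IsNondegenerateSystem Φ → (∀ i, 0 < (Φ i).coeff 0 ∧ 0 ≤ (Φ i).const) → (∀ δ : ℝ, 0 < δ → ∀ B : ℝ, ∃ C : ℝ, ∀ N : ℕ, 2 ≤ N → ∀ y r : ℕ → ℕ, (∀ d, y d ≤ N) → (∑ d ∈ Finset.Icc 1 ⌊(N : ℝ) ^ (1 - δ)⌋₊, |(∑ n ∈ (Finset.Icc 1 (y d)).filter (fun n : ℕ => n ≡ r d [MOD d]), ∏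 i, Literature.NumberTheory.Sieve.intVonMangoldt ((Φ i).eval ![(n : ℤ)])) - (if ∀ i, Int.gcd ((Φ i).eval ![(r d : ℤ)]) d = 1 then ((((Finset.range d).filter (fun ρ : ℕ => ∀ i, Int.gcd ((Φ i).eval ![(ρ : ℤ)]) d = 1)).card : ℝ))⁻¹ else 0) * ∑ n ∈ Finset.Icc 1 (y d), ∏ i, Literature.NumberTheory.Sieve.intVonMangoldt ((Φ i).eval ![(n : ℤ)])|) ≤ C * N / Real.log N ^ B)) →
    (∀ t : ℕ, 1 ≤ t → ∀ (Φ : Fin t → Literature.NumberTheory.Sieve.AffLinForm 1) (ψ : Literature.NumberTheory.Sieve.AffLinForm 1), Literature.NumberTheory.Sieve.IsNondegenerateSystem (Matrix.vecCons ψ Φ) → (∀ i, 0 < (Φ i).coeff 0 ∧ 0 ≤ (Φ i).const) → (0 < ψ.coeff 0 ∧ 0 ≤ ψ.const) → (∃ ε₀ : ℝ, 0 < ε₀ ∧ ∀ A : ℝ, 0 < A → ∃ C : ℝ, ∃ N₀ : ℕ, ∀ N : ℕ, N₀ ≤ N → ∀ w y : ℕ → ℕ, (∀ q, y q ≤ N)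 → (∑ q ∈ Finset.Icc 1 ⌊(N : ℝ) ^ ε₀⌋₊, |∑ n ∈ (Finset.Icc 1 (y q)).filter (fun n : ℕ => n ≡ w q [MOD q]), (ArithmeticFunction.liouville (Int.toNat (ψ.eval ![(n : ℤ)])) : ℝ) * ∏ i, Literature.NumberTheory.Sieve.intVonMangoldt ((Φ i).eval ![(n : ℤ)])|) ≤ C * N / Real.log N ^ A)) →
    ((∀ t : ℕ, 1 ≤ t → ∀ Φ : Fin t → Literature.NumberTheory.Sieve.AffLinForm 1, Literature.NumberTheory.Sieve.IsNondegenerateSystem Φ → (∀ i, 0 < (Φ i).coeff 0 ∧ 0 ≤ (Φ i).const) → ((fun N : ℕ => ∑ n ∈ Finset.Icc 1 N, ∏ i, Literature.NumberTheory.Sieve.intVonMangoldt ((Φ i).eval ![(n : ℤ)]) - Literature.NumberTheory.Sieve.singularProduct Φ * N) =o[Filter.atTop] fun N : ℕ => (N : ℝ))) →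
      ∀ (t L : ℕ), 1 ≤ t → ∀ ε : ℝ, 0 < ε → ∃ N₀ : ℕ, ∀ N : ℕ, N₀ ≤ N → ∀ Ψ : Fin t → Literature.NumberTheory.Sieve.AffLinForm 1, Literature.NumberTheory.Sieve.IsNondegenerateSystem Ψ → Literature.NumberTheory.Sieve.affLinSize Ψ N ≤ L → ∀ K : Set (Fin 1 → ℝ), Convex ℝ K → K ⊆ Literature.NumberTheory.Sieve.realBox 1 N → |Literature.NumberTheory.Sieve.vonMangoldtSum Ψ K N - Literature.NumberTheory.Sieve.archFactor Ψ K * Literature.NumberTheory.Sieve.singularProduct Ψ| ≤ ε * (N : ℝ)) →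
    Summit.Parity.GeneralizedHardyLittlewood.Theses.LiouvilleShiftedTables.PairsToGHL := by
  intro hE hL hA hR
  have hD : DicksonFibration.DimOne := hR (hE hL hA)
  exact PairsToGHLReduction.pairsToGHL_of_dimOne hD

/-! ### Certificates (sorry-free): the residual smuggles nothing upward -/

section Certificates

open Finset Filter Literature.NumberTheory.Sieve
open scoped ArithmeticFunction.vonMangoldt
open Summit.Parity.GeneralizedHardyLittlewood.Theorems.PairsToGHL
open Summit.Parity.GeneralizedHardyLittlewood.Theorems.PairsToGHL.Negative

/-- `BoundedDickson → PairsHL`: the route's target is the `t = 2`, unit-slope, fixed-shift instance of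
the residual's HYPOTHESIS (Green–Tao dictionary of `(n, n+h)`: `vonMangoldtSum_shiftPairSystem`,
`archFactor_shiftPairSystem`, `singularSeries_pair_eq_singularProduct`). [cite: GreenTao2010, Example 1] -/
theorem pairsHL_of_boundedDickson
    (hB : ∀ (t : ℕ) (Φ : Fin t → Literature.NumberTheory.Sieve.AffLinForm 1), 1 ≤ t → Literature.NumberTheory.Sieve.IsNondegenerateSystem Φ → ∀ ε : ℝ, 0 < ε → ∃ N₀ : ℕ, ∀ N : ℕ, N₀ ≤ N → ∀ K : Set (Fin 1 → ℝ), Convex ℝ K → K ⊆ Literature.NumberTheory.Sieve.realBox 1 N → |Literature.NumberTheory.Sieve.vonMangoldtSum Φ K N - Literature.NumberTheory.Sieve.archFactor Φ K * Literature.NumberTheory.Sieve.singularProduct Φ| ≤ ε * N) :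
    LiouvilleShiftedTables.PairsHL := by
  intro h hh
  have hh0 : h ≠ 0 := by omega
  rw [Asymptotics.isLittleO_iff]
  intro c hc
  obtain ⟨N₀, hN₀⟩ := hB 2 (shiftPairSystem (h : ℤ)) (by norm_num)
    (isNondegenerateSystem_shiftPairSystem_iff.mpr (by exact_mod_cast hh0)) c hc
  rw [Filter.eventually_atTop]
  refine ⟨N₀, fun N hN => ?_⟩
  have hGN := hN₀ N hN (realBox 1 N) (convex_Icc _ _) subset_rfl
  rw [vonMangoldtSum_shiftPairSystem, archFactor_shiftPairSystem,
    ← singularSeries_pair_eq_singularProduct hh0] at hGN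
  rw [Real.norm_eq_abs, Real.norm_eq_abs, Nat.abs_cast, mul_comm (singularSeries _) (N : ℝ)]
  exact hGN

/-- **The residual is WEAKER than the crux**: `PairsToGHL → (BoundedDickson → DimOne)`
(`pairsHL_of_boundedDickson` + p96099). [folklore] -/
theorem shiftLift_of_pairsToGHL (hX : LiouvilleShiftedTables.PairsToGHL) :
    (∀ (t : ℕ) (Φ : Fin t → Literature.NumberTheory.Sieve.AffLinForm 1), 1 ≤ t → Literature.NumberTheory.Sieve.IsNondegenerateSystem Φ → ∀ ε : ℝ, 0 < ε → ∃ N₀ : ℕ, ∀ N : ℕ, N₀ ≤ N → ∀ K : Set (Fin 1 → ℝ), Convex ℝ K → K ⊆ Literature.NumberTheory.Sieve.realBox 1 N → |Literature.NumberTheory.Sieve.vonMangoldtSum Φ K N - Literature.NumberTheory.Sieve.archFactor Φ K * Literature.NumberTheory.Sieve.singularProduct Φ| ≤ ε * N) →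
      DicksonFibration.DimOne :=
  fun hB => PairsToGHLReduction.pairsToGHL_iff_pairsHL_imp_dimOne.mp hX (pairsHL_of_boundedDickson hB)

/-- For a FIXED system the Green–Tao size is bounded for `N ≥ 1`: `‖Φ‖_N ≤ ‖Φ‖_1`. [cite: GreenTao2010, (1.1)] -/
theorem affLinSize_le_affLinSize_one {t : ℕ} (Φ : Fin t → AffLinForm 1) {N : ℕ} (hN : 1 ≤ N) :
    affLinSize Φ N ≤ affLinSize Φ 1 := by
  unfold affLinSize
  have hN' : (1 : ℝ) ≤ (N : ℝ) := by exact_mod_cast hN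
  refine add_le_add le_rfl (Finset.sum_le_sum fun i _ => ?_)
  rw [div_one, abs_div, Nat.abs_cast]
  exact div_le_self (abs_nonneg _) hN'

/-- **The residual's hypothesis is implied by its conclusion**: `DimOne → BoundedDickson` (a fixed
system has size `≤ ⌈‖Φ‖_1⌉` at every scale `N ≥ 1`). [cite: GreenTao2010, Conj. 1.2] -/
theorem boundedDickson_of_dimOne (hD : DicksonFibration.DimOne) :
    ∀ (t : ℕ) (Φ : Fin t → Literature.NumberTheory.Sieve.AffLinForm 1), 1 ≤ t → Literature.NumberTheory.Sieve.IsNondegenerateSystem Φ → ∀ ε : ℝ, 0 < ε → ∃ N₀ : ℕ, ∀ N : ℕ, N₀ ≤ N → ∀ K : Set (Fin 1 → ℝ), Convex ℝ K → K ⊆ Literature.NumberTheory.Sieve.realBox 1 N → |Literature.NumberTheory.Sieve.vonMangoldtSum Φ K N - Literature.NumberTheory.Sieve.archFactor Φ K * Literature.NumberTheory.Sieve.singularProduct Φ| ≤ ε * N := by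
  intro t Φ ht hΦ ε hε
  obtain ⟨N₀, hN₀⟩ := hD t ⌈affLinSize Φ 1⌉₊ ht ε hε
  refine ⟨max N₀ 1, fun N hN K hK hKN => ?_⟩
  have hNN₀ : N₀ ≤ N := le_of_max_le_left hN
  have hN1 : 1 ≤ N := le_of_max_le_right hN
  have hL : affLinSize Φ N ≤ (⌈affLinSize Φ 1⌉₊ : ℕ) :=
    (affLinSize_le_affLinSize_one Φ hN1).trans (Nat.le_ceil _)
  exact hN₀ N hNN₀ Φ hΦ hL K hK hKN

end Certificates

end Summit.Parity.GeneralizedHardyLittlewood.Cruxes.PairsToGHL.SlopedLadder
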